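import Literature.Analysis.FluidPDE.ClassicalSolutionGalilean
import Literature.Analysis.FluidPDE.NSLerayHopf
import Literature.Analysis.FunctionSpaces.FlatTorusProofs
import HarnessLib

/-!
# Non-uniqueness of smooth space-periodic Navier–Stokes solutions with unnormalised pressure
# (Tao 2013, §1 after Prop. 1.7; §3, the Galilean symmetry; §4)

Literature file (topic `Analysis/FluidPDE`; every statement is a theorem, no named facts).
Source: T. Tao, *Localisation and compactness properties of the Navier–Stokes global regularity
problem*, Anal. PDE 6 (2013) 25–107 = arXiv:1108.1165 [Tao2013Localisation]; section / equation
numbers below are those of the arXiv text (held: `paper:arxiv-1108.1165`).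

## What is printed

* §1, after Prop. 1.7 (arXiv Prop. 7, "Elimination of forcing term"): "there is a technical quirk
  in the inhomogeneous periodic problem as formulated in Conjecture 1.6, due to the fact that the
  pressure `p` is not required to be periodic. This opens up a Galilean invariance in the problem
  … Proposition 1.7 exploits the technical loophole of non-periodic pressure. The same loophole
  can also be used to easily demonstrate failure of uniqueness for the periodic Navier-Stokes
  problem"; footnote: normalised pressure "is equivalent to requiring that the pressure be
  periodic with the same period as the solution `u`".
* §3 (Symmetries), the Galilean symmetry (arXiv eq. (galilean)):
  `ũ(t,x) = u(t, x − ∫₀ᵗ v) + v(t)`, `p̃(t,x) = p(t, x − ∫₀ᵗ v) − x · v′(t)`, `ũ₀ = u₀ + v(0)`,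
  `f̃(t,x) = f(t, x − ∫₀ᵗ v)`, "valid for any smooth function `v : ℝ → ℝ³`. One can carefully
  check that this symmetry indeed maps … smooth solutions to smooth solutions, and preserves
  periodicity (recall here that in our definition of a periodic solution, the pressure was not
  required to be periodic)."
* §4, first paragraph: these symmetries "can alter the velocity field `u` and pressure `p` without
  affecting the data `(u₀,f,T)`, thus leading to a breakdown of uniqueness for the Navier-Stokes
  equation"; Lemma 4.1 (ii) (arXiv Lemma 25): for a periodic smooth solution the pressure is the
  normalised pressure `+ x · a(t) + C(t)`.
* C. Fefferman's Clay problem description [FeffermanClay2006], statements (B), (D), condition (10)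
  (periodicity of `u` only, as printed) and the errata page of the CMI offprint ("the further
  condition `p(x + eⱼ, t) = p(x, t)` should be made explicit"); in the tree: the printed leaves
  `NavierStokesExistenceSmoothPeriodic` / `NavierStokesBreakdownPeriodic` and the erratum leaf
  `NavierStokesBreakdownPeriodicPressurePeriodic` (conjecture leaves, not imported here).

## What is formalised (in the frame path `ξ(t) = −∫₀ᵗ v`, so `v = −ξ′`, as in the tree's
`IsClassicalNSSolutionOn.galileanBoost`)

For a solution of Fefferman's system (1)–(3) on `E × [0,∞)` in the wave-0 sense
(`IsNavierStokesSolution ν f u₀ u p`, `IsSmoothOnHalfSpace u`, `IsSmoothOnHalfSpace p`) and smooth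
`ξ : ℝ → E`, `g : ℝ → ℝ` with `ξ(0) = 0`, `ξ′(0) = 0`, the boosted pair
`(u(t, y + ξ t) − ξ′(t), p(t, y + ξ t) + ⟪ξ″(t), y⟫ − g(t))`:
* `IsNavierStokesSolution.galileanBoost` — is again such a solution, with the SAME datum `u₀` and
  the force `f(t, y + ξ t)` (`= 0` if `f = 0`: `galileanBoost_zero`);
* `IsLatticePeriodic.galileanBoost_velocity` — has `ℤ^ι`-periodic velocity slices whenever `u` has
  (Fefferman's (10) as printed is preserved);
* `isLatticePeriodic_galileanBoost_pressure_iff` — has a periodic pressure slice at time `t` iff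
  `ξ″(t) = 0` (given `p(t)` periodic): the CMI-errata class contains no accelerated frame;
* `IsLatticePeriodic.eq_zero_of_forall_apply_add_eq` — a continuous lattice-periodic field cannot
  satisfy `v(y + a) = v(y) + b` with `b ≠ 0` (it is bounded:
  `IsLatticePeriodic.exists_forall_norm_le`); hence boosted velocities with `ξ′(t) ≠ 0` differ
  from `u(t)` and different accelerations give different solutions;
* **`setOf_periodicSolution_infinite`** — Tao's remark as a theorem: if the unforced periodic
  problem `(ν, u₀)` has ONE solution smooth on `E × [0,∞)` with `u(·,t)` periodic, it has
  infinitely many (the orbit `ξ_c(t) = c t² w`), all with the same datum;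
  `setOf_periodicSolution_zero_infinite` — unconditionally so at the datum `u₀ = 0`, every `ν`;
* the companion file `PeriodicGalileanFrameBlowup.lean` adds the accelerated rest frame on
  `[0, a)`: a smooth periodic solution that cannot be continued to `[0,∞)` although its data
  (`u₀ = 0`, `f = 0`) have a global smooth solution — "∃ one non-continuable smooth periodic
  solution" is not a statement of type (D) in the printed class (10).

Design: no new definitions; the boosted fields are written as the literal lambda terms of
`IsClassicalNSSolutionOn.galileanBoost` so that the lemmas compose syntactically. Not formalised:
Prop. 1.7 itself (elimination of the forcing term) and Lemma 4.1 (structure of the pressure of a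
periodic smooth solution), which need the periodic Laplacian / Liouville's theorem.

## References

* [Tao2013Localisation] T. Tao, Anal. PDE 6 (2013) 25–107, arXiv:1108.1165: §1 (after Prop. 1.7),
  §3 eq. (galilean), §4 ¶1 and Lemma 4.1 (ii).
* [FeffermanClay2006] C. L. Fefferman, Existence and smoothness of the Navier–Stokes equation, CMI
  (2000/2006): (B), (D), (8)–(11), errata page.
* [MajdaBertozzi2002] A. J. Majda, A. L. Bertozzi, Vorticity and Incompressible Flow, CUP 2002,
  §1.2 (Galilean invariance) — the tree's `IsClassicalNSSolutionOn.galileanBoost`.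
-/

noncomputable section

open Set Function Filter InnerProductSpace
open scoped ContDiff RealInnerProductSpace Topology Laplacian

namespace Literature.Analysis.FluidPDE

/-! ### Lattice periodicity under translations, constants and linear potentials -/

section Periodic

variable {ι : Type*} [Fintype ι] [DecidableEq ι] {F : Type*}

omit [Fintype ι] in
/-- A translate of a lattice-periodic field is lattice periodic (Tao 2013, §3: spatial
translation "preserves … periodicity"). [cite: Tao2013Localisation, §3 eq. (translate)] -/
theorem IsLatticePeriodic.comp_add_right {v : EuclideanSpace ℝ ι → F} (hv : IsLatticePeriodic v)
    (a : EuclideanSpace ℝ ι) : IsLatticePeriodic (fun y => v (y + a)) := by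
  intro j y
  show v (y + EuclideanSpace.single j 1 + a) = v (y + a)
  rw [add_right_comm]
  exact hv j (y + a)

omit [Fintype ι] in
/-- Subtracting a constant preserves lattice periodicity (the `+ v(t)` part of the Galilean symmetry
"preserves periodicity"). [cite: Tao2013Localisation, §3 eq. (galilean)] -/
theorem IsLatticePeriodic.sub_const [Sub F] {v : EuclideanSpace ℝ ι → F} (hv : IsLatticePeriodic v)
    (c : F) : IsLatticePeriodic (fun y => v y - c) := by
  intro j y
  show v (y + EuclideanSpace.single j 1) - c = v y - c
  rw [hv j y]

omit [Fintype ι] in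
/-- Spatially constant fields are lattice periodic (the boosted rest state `v(t)` is a periodic
velocity). [cite: Tao2013Localisation, §3 eq. (galilean)] -/
theorem isLatticePeriodic_const (c : F) : IsLatticePeriodic (fun _ : EuclideanSpace ℝ ι => c) :=
  fun _ _ => rfl

/-- **The linear potential `⟪b, y⟫` is periodic only if `b = 0`.** For a lattice-periodic `q`,
the field `y ↦ q y + ⟪b, y⟫ − c` is lattice periodic iff `b = 0` (translating by `eⱼ` adds
`bⱼ`). This is why the pressure `p − x · v′(t)` of the Galilean symmetry is periodic only for
unaccelerated frames (Tao 2013, §3: the symmetry "destroys the pressure normalisation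
property"; footnote to (1.8): normalised pressure ≈ periodic pressure).
[cite: Tao2013Localisation, §3 eq. (galilean) and footnote to eq. (normalised)] -/
theorem isLatticePeriodic_add_inner_sub_iff {q : EuclideanSpace ℝ ι → ℝ} (hq : IsLatticePeriodic q)
    (b : EuclideanSpace ℝ ι) (c : ℝ) :
    IsLatticePeriodic (fun y => q y + ⟪b, y⟫ - c) ↔ b = 0 := by
  constructor
  · intro h
    ext j
    have h1 := h j 0
    have h2 := hq j 0
    simp only [zero_add] at h1 h2
    rw [h2, inner_zero_right, EuclideanSpace.inner_single_right] at h1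
    simpa using h1
  · rintro rfl
    simpa using hq.sub_const c

/-- **A continuous lattice-periodic field is bounded**: a `1`-periodic function in every
coordinate is a function on the compact torus `𝕋^ι = ℝ^ι/ℤ^ι` (Grafakos, §3.1.1; tree
`Torus.descend`, `Torus.lift_descend_holds`), and a continuous function on a compact space is
bounded. [cite: Grafakos2014, §3.1.1] -/
theorem IsLatticePeriodic.exists_forall_norm_le {F : Type*} [NormedAddCommGroup F]
    {v : EuclideanSpace ℝ ι → F} (hv : IsLatticePeriodic v) (hc : Continuous v) :
    ∃ C : ℝ, ∀ x, ‖v x‖ ≤ C := by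
  have hper : Literature.Analysis.FunctionSpaces.Torus.IsLatticePeriodic v := hv
  have hlift := Literature.Analysis.FunctionSpaces.Torus.lift_descend_holds v hper
  have hcont : Continuous (Literature.Analysis.FunctionSpaces.Torus.descend v hper) := by
    rw [← Literature.Analysis.FunctionSpaces.Torus.continuous_lift_iff, hlift]
    exact hc
  obtain ⟨C, hC⟩ := isCompact_univ.exists_bound_of_continuousOn hcont.continuousOn
  refine ⟨C, fun x => ?_⟩
  have hx : v x = Literature.Analysis.FunctionSpaces.Torus.lift
      (Literature.Analysis.FunctionSpaces.Torus.descend v hper) x := by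
    rw [hlift]
  rw [hx, Literature.Analysis.FunctionSpaces.Torus.lift_apply]
  exact hC _ (mem_univ _)

/-- **A continuous lattice-periodic field has no nonzero "translation drift"**: if
`v (y + a) = v y + b` for all `y`, then `b = 0` (iterate to `v (n a) = v 0 + n b` and use
boundedness). Applied to `a = ξ(t)`, `b = ξ′(t)` this says that the Galilean symmetry with
`ξ′(t) ≠ 0` really changes the velocity field at time `t` (Tao 2013, §4: the symmetries "alter
the velocity field"). [cite: Tao2013Localisation, §4 ¶1] -/
theorem IsLatticePeriodic.eq_zero_of_forall_apply_add_eq {F : Type*} [NormedAddCommGroup F]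
    [NormedSpace ℝ F] {v : EuclideanSpace ℝ ι → F} (hv : IsLatticePeriodic v) (hc : Continuous v)
    {a : EuclideanSpace ℝ ι} {b : F} (h : ∀ y, v (y + a) = v y + b) : b = 0 := by
  obtain ⟨C, hC⟩ := hv.exists_forall_norm_le hc
  by_contra hb
  have hb' : 0 < ‖b‖ := norm_pos_iff.2 hb
  have iter : ∀ n : ℕ, v ((n : ℝ) • a) = v 0 + (n : ℝ) • b := by
    intro n
    induction n with
    | zero => simp
    | succ n ih =>
        have e : ((n + 1 : ℕ) : ℝ) • a = (n : ℝ) • a + a := by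
          rw [Nat.cast_succ, add_smul, one_smul]
        rw [e, h, ih, Nat.cast_succ, add_smul, one_smul, add_assoc]
  obtain ⟨n, hn⟩ := exists_nat_gt ((C + ‖v 0‖) / ‖b‖)
  have h1 : ‖v ((n : ℝ) • a)‖ ≤ C := hC _
  have h2 : (n : ℝ) * ‖b‖ ≤ ‖v ((n : ℝ) • a)‖ + ‖v 0‖ := by
    have e : (n : ℝ) • b = v ((n : ℝ) • a) - v 0 := by rw [iter n]; abel
    calc (n : ℝ) * ‖b‖ = ‖(n : ℝ) • b‖ := by rw [norm_smul, Real.norm_natCast]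
      _ = ‖v ((n : ℝ) • a) - v 0‖ := by rw [e]
      _ ≤ ‖v ((n : ℝ) • a)‖ + ‖v 0‖ := norm_sub_le _ _
  have h3 : (C + ‖v 0‖) / ‖b‖ * ‖b‖ = C + ‖v 0‖ := div_mul_cancel₀ _ hb'.ne'
  nlinarith [mul_lt_mul_of_pos_right hn hb']

end Periodic

/-! ### The Galilean symmetry on Fefferman's solution class on `E × [0,∞)` -/

section Boost

variable {E : Type*} [NormedAddCommGroup E] [InnerProductSpace ℝ E] [FiniteDimensional ℝ E]
variable {ν : ℝ} {f u : ℝ → E → E} {u₀ : E → E} {p : ℝ → E → ℝ}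

/-- **Galilean symmetry of the Clay solution class (Tao 2013, §3 eq. (galilean); frame path
`ξ = −∫v`).** If `(u, p)` is smooth on `E × [0,∞)` and solves (1)–(3) with viscosity `ν`, force
`f` and datum `u₀`, and `ξ : ℝ → E`, `g : ℝ → ℝ` are smooth with `ξ(0) = 0`, `ξ′(0) = 0`, then
`(u(t, y + ξ t) − ξ′(t), p(t, y + ξ t) + ⟪ξ″(t), y⟫ − g(t))` is smooth on `E × [0,∞)` and solves
(1)–(3) with the same `ν`, the SAME datum `u₀`, and force `f(t, y + ξ t)`. (Tree:
`IsClassicalNSSolutionOn.galileanBoost` on `Ici 0` through the bridge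
`isNavierStokesSolution_and_smooth_iff`.) [cite: Tao2013Localisation, §3 eq. (galilean)] -/
theorem IsNavierStokesSolution.galileanBoost (hns : IsNavierStokesSolution ν f u₀ u p)
    (hu : IsSmoothOnHalfSpace u) (hp : IsSmoothOnHalfSpace p) {ξ : ℝ → E} (hξ : ContDiff ℝ ∞ ξ)
    (hξ0 : ξ 0 = 0) (hξ'0 : deriv ξ 0 = 0) {g : ℝ → ℝ} (hg : ContDiff ℝ ∞ g) :
    IsNavierStokesSolution ν (fun t y => f t (y + ξ t)) u₀ (fun t y => u t (y + ξ t) - deriv ξ t)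
        (fun t y => p t (y + ξ t) + ⟪deriv (deriv ξ) t, y⟫ - g t) ∧
      IsSmoothOnHalfSpace (fun t y => u t (y + ξ t) - deriv ξ t) ∧
      IsSmoothOnHalfSpace (fun t y => p t (y + ξ t) + ⟪deriv (deriv ξ) t, y⟫ - g t) := by
  obtain ⟨hcl, h0⟩ := isNavierStokesSolution_and_smooth_iff.1 ⟨hns, hu, hp⟩
  have hb := hcl.galileanBoost (uniqueDiffOn_Ici 0) hξ hg
  have h0' : (fun t y => u t (y + ξ t) - deriv ξ t) 0 = u₀ := by
    funext y
    simp [hξ0, hξ'0, h0]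
  exact isNavierStokesSolution_and_smooth_iff.2 ⟨hb, h0'⟩

/-- **Galilean symmetry, unforced problem** (`f ≡ 0` is frame invariant): the boosted pair of a
global smooth solution of the unforced system with datum `u₀` is a global smooth solution of the
unforced system with datum `u₀`. [cite: Tao2013Localisation, §3 eq. (galilean)] -/
theorem IsNavierStokesSolution.galileanBoost_zero (hns : IsNavierStokesSolution ν 0 u₀ u p)
    (hu : IsSmoothOnHalfSpace u) (hp : IsSmoothOnHalfSpace p) {ξ : ℝ → E} (hξ : ContDiff ℝ ∞ ξ)
    (hξ0 : ξ 0 = 0) (hξ'0 : deriv ξ 0 = 0) {g : ℝ → ℝ} (hg : ContDiff ℝ ∞ g) :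
    IsNavierStokesSolution ν 0 u₀ (fun t y => u t (y + ξ t) - deriv ξ t)
        (fun t y => p t (y + ξ t) + ⟪deriv (deriv ξ) t, y⟫ - g t) ∧
      IsSmoothOnHalfSpace (fun t y => u t (y + ξ t) - deriv ξ t) ∧
      IsSmoothOnHalfSpace (fun t y => p t (y + ξ t) + ⟪deriv (deriv ξ) t, y⟫ - g t) :=
  hns.galileanBoost hu hp hξ hξ0 hξ'0 hg

end Boost

/-! ### Periodicity: (10) as printed is preserved, the errata condition is not -/

section PeriodicBoost

variable {ι : Type*} [Fintype ι] [DecidableEq ι]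
variable {ν : ℝ} {u : ℝ → EuclideanSpace ℝ ι → EuclideanSpace ℝ ι}
  {u₀ : EuclideanSpace ℝ ι → EuclideanSpace ℝ ι} {p : ℝ → EuclideanSpace ℝ ι → ℝ}

omit [Fintype ι] in
/-- The Galilean symmetry "preserves periodicity (recall here that in our definition of a periodic
solution, the pressure was not required to be periodic)": if `u(·, t)` is `ℤ^ι`-periodic then so
is the boosted velocity `u(t, · + ξ t) − ξ′(t)`. [cite: Tao2013Localisation, §3 eq. (galilean)] -/
theorem IsLatticePeriodic.galileanBoost_velocity {t : ℝ} (hu : IsLatticePeriodic (u t))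
    (ξ : ℝ → EuclideanSpace ℝ ι) :
    IsLatticePeriodic ((fun s y => u s (y + ξ s) - deriv ξ s) t) :=
  (hu.comp_add_right (ξ t)).sub_const (deriv ξ t)

/-- **The boosted pressure is periodic exactly in unaccelerated frames**: if `p(·, t)` is periodic,
`p(t, · + ξ t) + ⟪ξ″(t), ·⟫ − g(t)` is periodic iff `ξ″(t) = 0`. So the CMI-errata solution class
(pressure periodic) is NOT preserved by the symmetry, which is how the erratum closes the loophole.
[cite: Tao2013Localisation, §3 eq. (galilean)] -/
theorem isLatticePeriodic_galileanBoost_pressure_iff {t : ℝ} (hp : IsLatticePeriodic (p t))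
    (ξ : ℝ → EuclideanSpace ℝ ι) (g : ℝ → ℝ) :
    IsLatticePeriodic ((fun s y => p s (y + ξ s) + ⟪deriv (deriv ξ) s, y⟫ - g s) t) ↔
      deriv (deriv ξ) t = 0 :=
  isLatticePeriodic_add_inner_sub_iff (hp.comp_add_right (ξ t)) _ _

/-- **The boost changes the velocity**: for `u(·, t)` continuous and periodic and `ξ′(t) ≠ 0`, the
boosted velocity at time `t` is a different field. [cite: Tao2013Localisation, §4 ¶1] -/
theorem IsLatticePeriodic.galileanBoost_velocity_ne {t : ℝ} (hu : IsLatticePeriodic (u t))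
    (hc : Continuous (u t)) {ξ : ℝ → EuclideanSpace ℝ ι} (hξ : deriv ξ t ≠ 0) :
    (fun s y => u s (y + ξ s) - deriv ξ s) t ≠ u t := by
  intro h
  apply hξ
  refine hu.eq_zero_of_forall_apply_add_eq hc (a := ξ t) fun y => ?_
  have := congrFun h y
  simp only at this
  rw [← this, sub_add_cancel]

/-- The quadratic frame path `ξ_c(t) = (c t²) w` and its derivatives. [folklore] -/
private theorem hasDerivAt_quadPath {E : Type*} [NormedAddCommGroup E] [NormedSpace ℝ E] (c : ℝ)
    (w : E) (t : ℝ) : HasDerivAt (fun s : ℝ => (c * s ^ 2) • w) ((c * (2 * t)) • w) t := by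
  have h : HasDerivAt (fun s : ℝ => c * s ^ 2) (c * (2 * t)) t := by
    simpa using ((hasDerivAt_pow 2 t).const_mul c)
  exact h.smul_const w

/-- `ξ_c′ = (2ct) w`. [folklore] -/
private theorem deriv_quadPath {E : Type*} [NormedAddCommGroup E] [NormedSpace ℝ E] (c : ℝ)
    (w : E) : deriv (fun s : ℝ => (c * s ^ 2) • w) = fun t => (c * (2 * t)) • w :=
  funext fun t => (hasDerivAt_quadPath c w t).deriv

/-- `ξ_c` is smooth. [folklore] -/
private theorem contDiff_quadPath {E : Type*} [NormedAddCommGroup E] [NormedSpace ℝ E] (c : ℝ)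
    (w : E) : ContDiff ℝ ∞ (fun s : ℝ => (c * s ^ 2) • w) :=
  (contDiff_const.mul (contDiff_id.pow 2)).smul contDiff_const

/-- **Failure of uniqueness in the printed periodic class (Tao 2013, §1 after Prop. 1.7; §4 ¶1).**
If the unforced periodic problem with viscosity `ν` and datum `u₀` has ONE solution `(u, p)`
smooth on `ℝ^ι × [0,∞)` with `u(·, t)` periodic for `t ≥ 0` (Fefferman's (1)–(3), (10), (11) as
printed: the pressure unconstrained), then it has infinitely many: the accelerated frames
`ξ_c(t) = c t² w`, `c ∈ ℝ`, `w ≠ 0`, give pairwise different solutions with the same datum.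
[cite: Tao2013Localisation, §1 (after Prop. 1.7) and §4 ¶1] -/
theorem setOf_periodicSolution_infinite (hns : IsNavierStokesSolution ν 0 u₀ u p)
    (hu : IsSmoothOnHalfSpace u) (hp : IsSmoothOnHalfSpace p)
    (hper : ∀ t, 0 ≤ t → IsLatticePeriodic (u t)) {w : EuclideanSpace ℝ ι} (hw : w ≠ 0) :
    {q : (ℝ → EuclideanSpace ℝ ι → EuclideanSpace ℝ ι) × (ℝ → EuclideanSpace ℝ ι → ℝ) |
        IsSmoothOnHalfSpace q.1 ∧ IsSmoothOnHalfSpace q.2 ∧ IsNavierStokesSolution ν 0 u₀ q.1 q.2 ∧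
          ∀ t, 0 ≤ t → IsLatticePeriodic (q.1 t)}.Infinite := by
  -- the family `c ↦ (boosted velocity, boosted pressure)` along `ξ_c(t) = (c t²) w`, gauge `g = 0`
  refine infinite_of_injective_forall_mem
    (f := fun c : ℝ =>
      ((fun t y => u t (y + (fun s : ℝ => (c * s ^ 2) • w) t) - deriv (fun s : ℝ => (c * s ^ 2) • w) t),
        (fun t y => p t (y + (fun s : ℝ => (c * s ^ 2) • w) t) +
          ⟪deriv (deriv (fun s : ℝ => (c * s ^ 2) • w)) t, y⟫ - (fun _ : ℝ => (0 : ℝ)) t))) ?_ ?_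
  · -- injectivity: equal velocities at `t = 1` force equal accelerations
    intro c₁ c₂ h
    have hv := congrArg (fun q : (ℝ → EuclideanSpace ℝ ι → EuclideanSpace ℝ ι) ×
      (ℝ → EuclideanSpace ℝ ι → ℝ) => q.1 1) h
    simp only [deriv_quadPath, mul_one, one_pow] at hv
    have key : ∀ y, u 1 (y + (c₁ - c₂) • w) = u 1 y + ((c₁ - c₂) * 2) • w := by
      intro y
      have := congrFun hv (y - c₂ • w)
      have e1 : y - c₂ • w + c₁ • w = y + (c₁ - c₂) • w := by rw [sub_smul]; abel
      have e2 : y - c₂ • w + c₂ • w = y := sub_add_cancel y _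
      rw [e1, e2] at this
      calc u 1 (y + (c₁ - c₂) • w)
          = u 1 (y + (c₁ - c₂) • w) - (c₁ * 2) • w + (c₁ * 2) • w := by abel
        _ = u 1 y - (c₂ * 2) • w + (c₁ * 2) • w := by rw [this]
        _ = u 1 y + ((c₁ - c₂) * 2) • w := by rw [sub_mul, sub_smul]; abel
    have hc : Continuous (u 1) :=
      ((isNavierStokesSolution_and_smooth_iff.1 ⟨hns, hu, hp⟩).1.contDiff_velocity
        (show (1 : ℝ) ∈ Ici 0 by norm_num)).continuous
    have hzero := (hper 1 zero_le_one).eq_zero_of_forall_apply_add_eq hc key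
    rw [smul_eq_zero] at hzero
    rcases hzero with h0 | h0
    · have : c₁ - c₂ = 0 := by
        rcases mul_eq_zero.1 h0 with h | h
        · exact h
        · norm_num at h
      linarith
    · exact absurd h0 hw
  · -- membership: each boosted pair is a global smooth `u`-periodic solution with datum `u₀`
    intro c
    have hξ0 : (fun s : ℝ => (c * s ^ 2) • w) 0 = 0 := by simp
    have hξ'0 : deriv (fun s : ℝ => (c * s ^ 2) • w) 0 = 0 := by
      rw [deriv_quadPath]; simp
    obtain ⟨h1, h2, h3⟩ := hns.galileanBoost_zero hu hp (contDiff_quadPath c w) hξ0 hξ'0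
      (g := fun _ => (0 : ℝ)) contDiff_const
    exact ⟨h2, h3, h1, fun t ht =>
      (hper t ht).galileanBoost_velocity (fun s : ℝ => (c * s ^ 2) • w)⟩

/-- The rest state `(u, p) = (0, 0)` is a solution of Fefferman's (1), (2), (3) with `f ≡ 0` and
datum `0`, smooth on `E × [0,∞)` ((6)/(11)): every term of (1)–(2) vanishes.
[cite: FeffermanClay2006, eqs. (1) (2) (3) (6)] -/
theorem isNavierStokesSolution_zero {E : Type*} [NormedAddCommGroup E] [InnerProductSpace ℝ E]
    [FiniteDimensional ℝ E] (ν : ℝ) :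
    IsNavierStokesSolution ν (0 : ℝ → E → E) 0 0 0 ∧ IsSmoothOnHalfSpace (0 : ℝ → E → E) ∧
      IsSmoothOnHalfSpace (0 : ℝ → E → ℝ) := by
  refine ⟨⟨fun t _ x => ?_, fun t _ x => ?_, rfl⟩, contDiffOn_const, contDiffOn_const⟩
  · simp only [Pi.zero_apply, map_zero, add_zero]
    have h1 : (0 : E → E) = fun _ => (0 : E) := rfl
    have h2 : (0 : E → ℝ) = fun _ => (0 : ℝ) := rfl
    rw [h1, h2, InnerProductSpace.laplacian_const, Pi.zero_apply, smul_zero,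
      show gradient (fun _ : E => (0 : ℝ)) x = 0 from by
        rw [gradient, fderiv_const_apply]; simp]
    simp
  · simp only [Pi.zero_apply, NSWave0.divergence]
    have h1 : (0 : E → E) = fun _ => (0 : E) := rfl
    rw [h1, fderiv_const_apply]
    simp

/-- **Unconditionally: the unforced periodic problem with ZERO datum has infinitely many global
smooth solutions with `u(·, t)` periodic**, for every viscosity `ν` (and `ι` nonempty): the
accelerated frames of the rest state, `u(t, y) = −2ct w`, `p(t, y) = 2c ⟪w, y⟫`. In the
CMI-errata class (pressure periodic) only `c = 0` survives (`isLatticePeriodic_galileanBoost_pressure_iff`).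
[cite: Tao2013Localisation, §1 (after Prop. 1.7) and §4 ¶1] -/
theorem setOf_periodicSolution_zero_infinite [Nonempty ι] (ν : ℝ) :
    {q : (ℝ → EuclideanSpace ℝ ι → EuclideanSpace ℝ ι) × (ℝ → EuclideanSpace ℝ ι → ℝ) |
        IsSmoothOnHalfSpace q.1 ∧ IsSmoothOnHalfSpace q.2 ∧ IsNavierStokesSolution ν 0 0 q.1 q.2 ∧
          ∀ t, 0 ≤ t → IsLatticePeriodic (q.1 t)}.Infinite := by
  obtain ⟨j⟩ := ‹Nonempty ι›
  obtain ⟨h1, h2, h3⟩ := isNavierStokesSolution_zero (E := EuclideanSpace ℝ ι) ν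
  have hw : (EuclideanSpace.single j (1 : ℝ) : EuclideanSpace ℝ ι) ≠ 0 := by
    intro h
    have := congrArg (fun v : EuclideanSpace ℝ ι => v j) h
    simp at this
  exact setOf_periodicSolution_infinite h1 h2 h3 (fun _ _ => isLatticePeriodic_const _) hw

end PeriodicBoost

end Literature.Analysis.FluidPDE

end
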